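import Summits.BirchSwinnertonDyer.BirchSwinnertonDyer.Theorems.SylvesterTwoHeegnerIndexLowerHalfFourTorsionMembersC
import Summits.BirchSwinnertonDyer.BirchSwinnertonDyer.Theorems.SylvesterTwoHeegnerIndexLowerHalfFourTorsionMembersD
import HarnessLib

/-!
# Route `SylvesterTwoHeegnerIndex` (rung K7t), crux `HeegnerIndexLowerAtTwoHSYOfFacts` (item 19477, twin
# of 19230): the `(ℤ/8)²` CERTIFICATE CONSUMER — what an `8`-descent datum «`Ш(E_p)[2] ⊆ 4·Ш(E_p)`»
# closes at the two LISTED members `p = 140557, 381181` (`#Ш_an = 64`)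
# (helper toward stmt-BirchSwinnertonDyer-19477; cell «bsd-cm», seat `bsd-cm-k7t-c3` gen 6; theorems only)

HONEST FRAMING (cell «bsd-cm», `run/shared/lean/pub/bsd-cm/`). The class 𝒞_HSY at `p = 2` is OPEN in
print and stays open here. Among the 79 `(ℤ/4)²`-members `p ≤ 4·10⁵` of the census, exactly two —
`p = 140557` and `p = 381181` — have CERTIFIED `#Ш_an(E_p) = 64` (kit j252371 / j253339; parts C/D of
the `(ℤ/4)²`-member files), so the LOWER crux there is EXACTLY `64 ∣ #Ш(E_p)`
(`sylvesterTwoHeegnerIndex_lower_140557_iff_64_dvd`), which `2`-descent + the Cassels–Tate pairing on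
`Sel₂` (PARI `ellrank = [1, 3, 0]`: a Klein four in `Ш[2]` with `Ш[2] ⊆ 2·Ш`, hence `16 ∣ #Ш`) does NOT
decide. The missing datum is one step up the `2`-power tower: «`Ш(E_p)[2] ⊆ 4·Ш(E_p)`», i.e. the
Cassels–Tate pairing between `Ш[2]` and `Ш[4]` vanishes — the output of an `8`-descent (Magma's
`EightDescent` / `CasselsTatePairing` on a `4`-cover and a `2`-cover; WANTED W-K7t-8descent, not
available on the cell's engines). THIS FILE is the kernel CONSUMER of that datum: THEOREMS ONLY
(0 definitions, 0 named facts, 0 `sorry`), nothing asserted about any member.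

§1 Finite abelian groups: a Klein four-group `{0, x, y, x+y} ⊆ G[2]` with `x, y ∈ 4·G` forces
   `(ℤ/8)² ↪ G`, hence `64 ∣ #G` (`sixtyfour_dvd_card_of_kleinFour_of_fourDivisible`).
§2 Member-generic consumers: `ord₂ #Ш_an ≤ 6` + Klein four in `Ш[2]` + `Ш[2] ⊆ 4·Ш` ⟹ the LOWER
   inequality in every frame (`lower_frame_of_kleinFour_fourDivisible`, `lower_member_of_cert64`) and
   `MissingLowerBoundAt W 2` (`missingLowerBoundAt_of_kleinFour_fourDivisible`).
§3 The two rows, CONDITIONAL on the displayed `8`-descent datum `hS8` (NOT held by the cell) and the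
   certified `hq : #Ш_an = 64`: `…heegnerIndexLowerAtTwoHSY_140557_of_eightDescent`,
   `…_381181_of_eightDescent`. If an `8`-descent ever reports «`Ш[2] ⊄ 4·Ш`» instead, then (with
   Cassels–Tate) `Ш(E_p)[2^∞] ≅ (ℤ/4)²`, `64 ∤ #Ш`, and the LOWER child `LowerOffV0HSY` (p471972's split)
   is REFUTED at that member given the facts — the kill criterion of the route, made kernel-precise.

PARTITION (D-0054): CornerF at `2` / O12 × {E_140557, E_381181} (the `#Ш_an = 64` rows of the
`(ℤ/4)²`-stratum; book230: 0 classes) × `p = 2` — types-the-object-of (certificate consumers for the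
off-`𝒱₀` LOWER child); closes no cell, no item; nothing booked; no label moves.
References (locators only): [HuShuYin2019] Thm. 1.3/1.4 (p. 3); [BurungaleFlach2024] Thm. 1.1, Cor. 2;
[Miller2011LMS] §1, Def. 1.1; [Cremona1997] §3.6; Cassels, J. reine angew. Math. 494 (1998) §1;
parents p422193 (part A consumers), parts C/D (rows), p457106, p471972.
-/

set_option autoImplicit false
-- the Theorems namespace `Summit.BirchSwinnertonDyer.BirchSwinnertonDyer.…` repeats a component by design (D-0017 layout)
set_option linter.dupNamespace false

noncomputable section

open scoped Classical

open WeierstrassCurve NumberField Literature.NumberTheory.EllipticCurves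
  Literature.NumberTheory.EllipticCurves.ModularForms
  Literature.NumberTheory.EllipticCurves.Rank1Residual
  Literature.NumberTheory.EllipticCurves.Rank1Residual.Typed
  Literature.NumberTheory.EllipticCurves.HuShuYin2019
  Summit.BirchSwinnertonDyer.Rank1Residual.P2
  Summit.BirchSwinnertonDyer.Rank1Residual.X12.Sylvester
  Summit.BirchSwinnertonDyer.BirchSwinnertonDyer.Theses.SylvesterTwoHeegnerIndex

namespace Summit.BirchSwinnertonDyer.BirchSwinnertonDyer.Theorems

namespace SylvesterTwoLowerCert

/-! ## §1 Finite abelian groups: a Klein four in `G[2] ∩ 4·G` gives `(ℤ/8)² ↪ G` -/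

section GroupTheory

variable {G : Type*} [AddCommGroup G]

/-- Quarters of a Klein four: if `4 • x'' = x`, `4 • y'' = y` with `x ≠ y` non-zero and killed by `2`,
an integer relation `a • x'' + b • y'' = 0` has coefficients divisible by `8`. [folklore] -/
theorem eight_dvd_of_rel_quarters {x y x'' y'' : G} (hx : (2 : ℤ) • x = 0) (hy : (2 : ℤ) • y = 0)
    (hx0 : x ≠ 0) (hy0 : y ≠ 0) (hxy : x ≠ y) (hx'' : (4 : ℤ) • x'' = x) (hy'' : (4 : ℤ) • y'' = y)
    (a b : ℤ) (h : a • x'' + b • y'' = 0) : 8 ∣ a ∧ 8 ∣ b := by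
  -- the halves `x' = 2 • x''`, `y' = 2 • y''` satisfy `2 • x' = x`, `2 • y' = y`
  have hx' : (2 : ℤ) • ((2 : ℤ) • x'') = x := by rw [smul_smul]; exact hx''
  have hy' : (2 : ℤ) • ((2 : ℤ) • y'') = y := by rw [smul_smul]; exact hy''
  -- multiply the relation by 2: `a • x' + b • y' = 0`, so `4 ∣ a, b`
  have h2 : a • ((2 : ℤ) • x'') + b • ((2 : ℤ) • y'') = 0 := by
    have := congrArg (fun z : G => (2 : ℤ) • z) h
    simp only [smul_add, smul_zero, smul_smul] at this
    rwa [smul_smul, smul_smul, mul_comm a 2, mul_comm b 2]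
  obtain ⟨⟨a₁, rfl⟩, ⟨b₁, rfl⟩⟩ := four_dvd_of_rel_halves hx hy hx0 hy0 hxy hx' hy' a b h2
  -- `(4a₁) • x'' + (4b₁) • y'' = a₁ • x + b₁ • y = 0`, so `2 ∣ a₁, b₁`
  have h1 : a₁ • x + b₁ • y = 0 := by
    rwa [mul_comm (4 : ℤ) a₁, mul_comm (4 : ℤ) b₁, mul_smul, mul_smul, hx'', hy''] at h
  obtain ⟨⟨a₂, rfl⟩, ⟨b₂, rfl⟩⟩ := two_dvd_of_rel hx hy hx0 hy0 hxy a₁ b₁ h1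
  exact ⟨⟨a₂, by ring⟩, ⟨b₂, by ring⟩⟩

/-- **A Klein four-group inside `G[2]` whose generators are quarters, `x = 4x''`, `y = 4y''`, forces
`64 ∣ #G`**: `(a, b) ↦ a • x'' + b • y''` embeds `(ℤ/8)²`. [folklore] -/
theorem sixtyfour_dvd_card_of_kleinFour_quarters {x y x'' y'' : G} (hx : (2 : ℤ) • x = 0)
    (hy : (2 : ℤ) • y = 0) (hx0 : x ≠ 0) (hy0 : y ≠ 0) (hxy : x ≠ y) (hx'' : (4 : ℤ) • x'' = x)
    (hy'' : (4 : ℤ) • y'' = y) : 64 ∣ Nat.card G := by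
  have h8x : (zmultiplesHom G x'') (8 : ℕ) = 0 := by
    change ((8 : ℕ) : ℤ) • x'' = 0
    rw [show ((8 : ℕ) : ℤ) = 2 * 4 by norm_num, mul_smul, hx'', hx]
  have h8y : (zmultiplesHom G y'') (8 : ℕ) = 0 := by
    change ((8 : ℕ) : ℤ) • y'' = 0
    rw [show ((8 : ℕ) : ℤ) = 2 * 4 by norm_num, mul_smul, hy'', hy]
  let fx : {f : ℤ →+ G // f (8 : ℕ) = 0} := ⟨zmultiplesHom G x'', h8x⟩
  let fy : {f : ℤ →+ G // f (8 : ℕ) = 0} := ⟨zmultiplesHom G y'', h8y⟩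
  let F : ZMod 8 × ZMod 8 →+ G := (ZMod.lift 8 fx).coprod (ZMod.lift 8 fy)
  have hF : Function.Injective F := by
    refine (injective_iff_map_eq_zero F).mpr fun ab hab => ?_
    obtain ⟨a, b⟩ := ab
    obtain ⟨m, rfl⟩ := ZMod.intCast_surjective a
    obtain ⟨m', rfl⟩ := ZMod.intCast_surjective b
    have h : m • x'' + m' • y'' = 0 := by
      simpa [F, fx, fy, AddMonoidHom.coprod_apply, ZMod.lift_coe] using hab
    obtain ⟨hm, hm'⟩ := eight_dvd_of_rel_quarters hx hy hx0 hy0 hxy hx'' hy'' m m' h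
    rw [Prod.mk_eq_zero, ZMod.intCast_zmod_eq_zero_iff_dvd, ZMod.intCast_zmod_eq_zero_iff_dvd]
    exact ⟨by exact_mod_cast hm, by exact_mod_cast hm'⟩
  have hcard : Nat.card (ZMod 8 × ZMod 8) = 64 := by
    rw [Nat.card_prod, Nat.card_zmod]
  exact hcard ▸ AddSubgroup.card_dvd_of_injective F hF

/-- **A Klein four-group inside `G[2]` together with `G[2] ⊆ 4·G` forces `64 ∣ #G`** — the shape of
an `8`-descent certificate: `Ш[2] ≅ (ℤ/2)²` and the Cassels–Tate pairing between `Ш[2]` and `Ш[4]`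
trivial. [folklore] -/
theorem sixtyfour_dvd_card_of_kleinFour_of_fourDivisible {x y : G} (hx : (2 : ℤ) • x = 0)
    (hy : (2 : ℤ) • y = 0) (hx0 : x ≠ 0) (hy0 : y ≠ 0) (hxy : x ≠ y)
    (hdiv4 : ∀ z : G, (2 : ℤ) • z = 0 → ∃ w : G, (4 : ℤ) • w = z) : 64 ∣ Nat.card G := by
  obtain ⟨x'', hx''⟩ := hdiv4 x hx
  obtain ⟨y'', hy''⟩ := hdiv4 y hy
  exact sixtyfour_dvd_card_of_kleinFour_quarters hx hy hx0 hy0 hxy hx'' hy''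

/-- `G[2] ⊆ 4·G` implies `G[2] ⊆ 2·G` (the `4`-descent datum is contained in the `8`-descent one).
[folklore] -/
theorem twoDivisible_of_fourDivisible
    (hdiv4 : ∀ z : G, (2 : ℤ) • z = 0 → ∃ w : G, (4 : ℤ) • w = z) :
    ∀ z : G, (2 : ℤ) • z = 0 → ∃ w : G, (2 : ℤ) • w = z := by
  intro z hz
  obtain ⟨w, hw⟩ := hdiv4 z hz
  exact ⟨(2 : ℤ) • w, by rw [smul_smul]; exact hw⟩

end GroupTheory

/-! ## §2 Member-generic consumers (`ord₂ #Ш_an ≤ 6`) -/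

section Consumers

variable {p : ℕ}

/-- **`ord₂ #Ш_an ≤ 6`, a Klein four-group in `Ш(W)[2]`, and `Ш(W)[2] ⊆ 4·Ш(W)` ⟹ the LOWER
inequality** in every Heegner frame, for `W ≅ E_p` in 𝒞_HSY: `ord₂ 𝔮 = ord₂ #Ш_an ≤ 6 ≤ ord₂ #Ш(W)`
(part A's graded consumer with `n = 6` and §1). Per-pair EVIDENCE consumer; the datum `hdiv4` is an
`8`-descent output the cell does not hold for any member. [cite: HuShuYin2019, Thm. 1.3 and Thm. 1.4 (p. 3)]
[cite: BurungaleFlach2024, Thm. 1.1 and Cor. 2] [cite: Miller2011LMS, §1 and Def. 1.1] -/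
theorem lower_frame_of_kleinFour_fourDivisible (W : WeierstrassCurve ℚ) [W.IsElliptic]
    [W.IsGloballyMinimal]
    (hHSY : thm14_threePart_product) (hBF : bsdTriple_of_hasCM_of_L_one_ne_zero)
    (hmod : hasEntireLFunction_rat) (hGZK : rank_eq_analyticRank_of_analyticRank_le_one)
    (hp : p.Prime) (h9 : p % 9 = 4 ∨ p % 9 = 7) (h3 : ¬ ∃ x : ZMod p, x ^ 3 = 3)
    (hW : ∃ C : VariableChange ℚ, C • W = cubeSumCurve (p : ℚ))
    {q : ℚ} (hq : shaAn W = (q : ℂ)) (hv : padicValRat 2 q ≤ 6)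
    (hK4 : ∃ x y : W.sha, (2 : ℤ) • x = 0 ∧ (2 : ℤ) • y = 0 ∧ x ≠ 0 ∧ y ≠ 0 ∧ x ≠ y)
    (hdiv4 : ∀ z : W.sha, (2 : ℤ) • z = 0 → ∃ w : W.sha, (4 : ℤ) • w = z)
    (N : ℕ) [NeZero N] (K : Type) [Field K] [NumberField K]
    (Dt : ModularParametrizationData W N) (H : HeegnerDatum N (NumberField.discr K)) (ι : K →+* ℂ)
    (P : (W.baseChange K).toAffine.Point)
    (hGZ : gross_zagier N W K) (hKo : kolyvagin N W K)
    (hK : IsImaginaryQuadratic K) (hHN : SatisfiesHeegnerHypothesis N K)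
    (hP : WeierstrassCurve.Affine.Point.map ι.toRatAlgHom P = heegnerPointComplex Dt H)
    (hLt : (W.quadraticTwist (NumberField.discr K : ℚ)).entireLFunction 1 ≠ 0)
    (Wd : WeierstrassCurve ℚ) [Wd.IsElliptic] [Wd.IsGloballyMinimal] (Cd : VariableChange ℚ)
    (hWd : Cd • W.quadraticTwist (NumberField.discr K : ℚ) = Wd)
    {k : ℕ} (hk : k = 1 ∨ k = 2)
    (hkiff : k = 2 ↔ ∀ y : W.toAffine.Point, ∃ Q : (W.baseChange K).toAffine.Point,
      QuadraticDescent.incl K W y - (2 : ℤ) • Q ∈ AddCommGroup.torsion (W.baseChange K).toAffine.Point) :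
    padicValRat 2 (cmHeegnerIndexQuotient W K P Dt.c k Wd Cd.u) ≤ padicValNat 2 (Nat.card W.sha) := by
  obtain ⟨x, y, hx, hy, hx0, hy0, hxy⟩ := hK4
  exact lower_frame_of_shaAn_of_pow_dvd_card W hHSY hBF hmod hGZK hp h9 h3 hW hq (n := 6)
    (by exact_mod_cast hv)
    (by simpa using sixtyfour_dvd_card_of_kleinFour_of_fourDivisible hx hy hx0 hy0 hxy hdiv4) N K Dt
    H ι P hGZ hKo hK hHN hP hLt Wd Cd hWd hk hkiff

/-- **Miller-currency form**: same inputs ⟹ `MissingLowerBoundAt W 2` (`2⁶ ∣ #Ш(W)` and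
`ord₂ #Ш_an ≤ 6`; p457106's `missingLowerBoundAt_iff_pow_dvd`). [cite: HuShuYin2019, Thm. 1.3 and Thm. 1.4 (p. 3)]
[cite: Miller2011LMS, §1 and Def. 1.1] -/
theorem missingLowerBoundAt_of_kleinFour_fourDivisible (W : WeierstrassCurve ℚ) [W.IsElliptic]
    [W.IsGloballyMinimal]
    (hHSY : thm14_threePart_product) (hBF : bsdTriple_of_hasCM_of_L_one_ne_zero)
    (hmod : hasEntireLFunction_rat)
    (hp : p.Prime) (h9 : p % 9 = 4 ∨ p % 9 = 7) (h3 : ¬ ∃ x : ZMod p, x ^ 3 = 3)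
    (hW : ∃ C : VariableChange ℚ, C • W = cubeSumCurve (p : ℚ))
    {q : ℚ} (hq : shaAn W = (q : ℂ)) (hv : padicValRat 2 q ≤ 6)
    (hK4 : ∃ x y : W.sha, (2 : ℤ) • x = 0 ∧ (2 : ℤ) • y = 0 ∧ x ≠ 0 ∧ y ≠ 0 ∧ x ≠ y)
    (hdiv4 : ∀ z : W.sha, (2 : ℤ) • z = 0 → ∃ w : W.sha, (4 : ℤ) • w = z) :
    MissingLowerBoundAt W 2 := by
  haveI : Fact (Nat.Prime 2) := ⟨Nat.prime_two⟩
  obtain ⟨-, hfin, -⟩ :=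
    Summit.BirchSwinnertonDyer.Rank1Residual.X12.CubeSumFamilies.bsdp_three_of_thm14' hHSY hBF hmod hp h9 h3 W hW
  haveI := hfin
  obtain ⟨x, y, hx, hy, hx0, hy0, hxy⟩ := hK4
  have h64 : 2 ^ 6 ∣ Nat.card W.sha := by
    simpa using sixtyfour_dvd_card_of_kleinFour_of_fourDivisible hx hy hx0 hy0 hxy hdiv4
  have hcard : Nat.card W.sha ≠ 0 := (Nat.card_pos (α := W.sha)).ne'
  refine ⟨q, hq, ?_⟩
  rw [WeierstrassCurve.shaOrder]
  have h6 : (6 : ℤ) ≤ padicValNat 2 (Nat.card W.sha) := by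
    exact_mod_cast (padicValNat_dvd_iff_le hcard).mp h64
  exact hv.trans h6

/-- **Member-generic LOWER consumer for the `#Ш_an = 64` rows.** At an 𝒞_HSY parameter `p`, from
`PublishedFactsTwo` and two DISPLAYED per-curve certificates — `hq : #Ш_an(E_p) = q` with `ord₂ q ≤ 6`,
and `hS8 :` a Klein four-group in `Ш(E_p)[2]` with `Ш(E_p)[2] ⊆ 4·Ш(E_p)` (an `8`-descent datum: then
`(ℤ/8)² ↪ Ш(E_p)`, `64 ∣ #Ш(E_p)`) — the body of `HeegnerIndexLowerAtTwoHSY` at `p` holds for EVERY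
global minimal model and EVERY Heegner frame. CONDITIONAL; EVIDENCE consumer; says nothing about other
`p`, and the cell holds `hS8` for NO member today. [cite: HuShuYin2019, Thm. 1.3 and Thm. 1.4 (p. 3)]
[cite: BurungaleFlach2024, Thm. 1.1 and Cor. 2] [cite: Miller2011LMS, §1 and Def. 1.1] [cite: Cremona1997, §3.6] -/
theorem lower_member_of_cert64
    (hsy : Nat.Prime p ∧ (p % 9 = 4 ∨ p % 9 = 7) ∧ ¬ ∃ x : ZMod p, x ^ 3 = 3)
    (hF : PublishedFactsTwo) {q : ℚ} (hv : padicValRat 2 q ≤ 6)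
    (hq : ∀ (W : WeierstrassCurve ℚ) [W.IsElliptic] [W.IsGloballyMinimal],
      (∃ C : VariableChange ℚ, C • W = cubeSumCurve (p : ℚ)) → shaAn W = (q : ℂ))
    (hS8 : ∀ (W : WeierstrassCurve ℚ) [W.IsElliptic] [W.IsGloballyMinimal],
      (∃ C : VariableChange ℚ, C • W = cubeSumCurve (p : ℚ)) →
        (∃ x y : W.sha, (2 : ℤ) • x = 0 ∧ (2 : ℤ) • y = 0 ∧ x ≠ 0 ∧ y ≠ 0 ∧ x ≠ y) ∧
        (∀ z : W.sha, (2 : ℤ) • z = 0 → ∃ w : W.sha, (4 : ℤ) • w = z)) :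
    ∀ (W : WeierstrassCurve ℚ) [W.IsElliptic] [W.IsGloballyMinimal],
      (∃ C : VariableChange ℚ, C • W = cubeSumCurve (p : ℚ)) →
      ∀ (N : ℕ) [NeZero N] (K : Type) [Field K] [NumberField K]
        (Dt : ModularParametrizationData W N) (H : HeegnerDatum N (NumberField.discr K)) (ι : K →+* ℂ)
        (P : (W.baseChange K).toAffine.Point) (Wd : WeierstrassCurve ℚ) [Wd.IsElliptic]
        [Wd.IsGloballyMinimal] (Cd : VariableChange ℚ) (k : ℕ),
        W.HasCM → W.analyticRank = 1 → IsImaginaryQuadratic K → SatisfiesHeegnerHypothesis N K →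
        WeierstrassCurve.Affine.Point.map ι.toRatAlgHom P = heegnerPointComplex Dt H →
        (W.quadraticTwist (NumberField.discr K : ℚ)).entireLFunction 1 ≠ 0 →
        Cd • W.quadraticTwist (NumberField.discr K : ℚ) = Wd → (k = 1 ∨ k = 2) →
        (k = 2 ↔ ∀ y : W.toAffine.Point, ∃ Q : (W.baseChange K).toAffine.Point,
          QuadraticDescent.incl K W y - (2 : ℤ) • Q ∈ AddCommGroup.torsion (W.baseChange K).toAffine.Point) →
        padicValRat 2 (cmHeegnerIndexQuotient W K P Dt.c k Wd Cd.u) ≤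
          padicValNat 2 (Nat.card W.sha) := by
  obtain ⟨hHSY, hBF, hmod, -, -, hGZ, hKo, hGZK, -, -, -⟩ := hF
  obtain ⟨hpr, h9, h3⟩ := hsy
  intro W _ _ hW N _ K _ _ Dt H ι P Wd _ _ Cd k _ _ hK hHN hP hLt hWd hk hkiff
  obtain ⟨hK4, hdiv4⟩ := hS8 W hW
  exact lower_frame_of_kleinFour_fourDivisible W hHSY hBF hmod hGZK hpr h9 h3 hW (hq W hW) hv hK4 hdiv4
    N K Dt H ι P (hGZ N W K) (hKo N W K) hK hHN hP hLt Wd Cd hWd hk hkiff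

/-- **What `BSD(E_p, 2)` amounts to at such a member**, granted `PublishedFactsTwo`, `ord₂ q = 6`
exactly and the `8`-descent datum: `BSDp W 2 ⟺ ¬ 128 ∣ #Ш(W)` — only «`Ш(E_p)[2^∞] ≅ (ℤ/8)²` EXACTLY»
is left (by Cassels–Tate this is automatic once `Ш[2] ≅ (ℤ/2)²` exactly, `dim Sel₂ = 3`; not
invoked here). CONDITIONAL; EVIDENCE consumer. [cite: HuShuYin2019, Thm. 1.3 and Thm. 1.4 (p. 3)]
[cite: BurungaleFlach2024, Thm. 1.1 and Cor. 2] [cite: Miller2011LMS, §1 and Def. 1.1] -/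
theorem bsdTwo_member_iff_not_128_dvd_of_cert64
    (hsy : Nat.Prime p ∧ (p % 9 = 4 ∨ p % 9 = 7) ∧ ¬ ∃ x : ZMod p, x ^ 3 = 3)
    (hF : PublishedFactsTwo) {q : ℚ} (hv : padicValRat 2 q = 6)
    (hq : ∀ (W : WeierstrassCurve ℚ) [W.IsElliptic] [W.IsGloballyMinimal],
      (∃ C : VariableChange ℚ, C • W = cubeSumCurve (p : ℚ)) → shaAn W = (q : ℂ))
    (hS8 : ∀ (W : WeierstrassCurve ℚ) [W.IsElliptic] [W.IsGloballyMinimal],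
      (∃ C : VariableChange ℚ, C • W = cubeSumCurve (p : ℚ)) →
        (∃ x y : W.sha, (2 : ℤ) • x = 0 ∧ (2 : ℤ) • y = 0 ∧ x ≠ 0 ∧ y ≠ 0 ∧ x ≠ y) ∧
        (∀ z : W.sha, (2 : ℤ) • z = 0 → ∃ w : W.sha, (4 : ℤ) • w = z))
    (W : WeierstrassCurve ℚ) [W.IsElliptic] [W.IsGloballyMinimal]
    (hW : ∃ C : VariableChange ℚ, C • W = cubeSumCurve (p : ℚ)) :
    BSDp W 2 ↔ ¬ 128 ∣ Nat.card W.sha := by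
  haveI : Fact (Nat.Prime 2) := ⟨Nat.prime_two⟩
  obtain ⟨hHSY, hBF, hmod, -, -, -, -, hGZK, -, -, -⟩ := hF
  obtain ⟨hpr, h9, h3⟩ := hsy
  obtain ⟨hr, hfin, -⟩ :=
    Summit.BirchSwinnertonDyer.Rank1Residual.X12.CubeSumFamilies.bsdp_three_of_thm14' hHSY hBF hmod hpr h9 h3 W hW
  haveI := hfin
  have hq' : shaAn W = (q : ℂ) := hq W hW
  obtain ⟨⟨x, y, hx, hy, hx0, hy0, hxy⟩, hdiv4⟩ := hS8 W hW
  have h64 : 2 ^ 6 ∣ Nat.card W.sha := by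
    simpa using sixtyfour_dvd_card_of_kleinFour_of_fourDivisible hx hy hx0 hy0 hxy hdiv4
  have hcard : Nat.card W.sha ≠ 0 := (Nat.card_pos (α := W.sha)).ne'
  have hrank : W.mordellWeilRank = W.analyticRank := (hGZK W (by rw [hr])).1
  have hprim : padicValNat 2 (Nat.card (AddCommGroup.primaryComponent W.sha 2)) =
      padicValNat 2 (Nat.card W.sha) := padicValNat_card_addPrimaryComponent 2
  have h6 : 6 ≤ padicValNat 2 (Nat.card W.sha) := (padicValNat_dvd_iff_le hcard).mp h64
  constructor
  · rintro ⟨-, -, q', hqq, hvq⟩ h128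
    have hqq' : q' = q := by exact_mod_cast hqq.symm.trans hq'
    rw [hqq', hv, hprim] at hvq
    have h7 : 7 ≤ padicValNat 2 (Nat.card W.sha) :=
      (padicValNat_dvd_iff_le hcard).mp (by simpa using h128)
    omega
  · intro h128
    have hlt : padicValNat 2 (Nat.card W.sha) < 7 := by
      by_contra hge
      exact h128 (by simpa using (padicValNat_dvd_iff_le hcard).mpr (not_lt.mp hge))
    refine ⟨hrank, Finite.of_injective _ Subtype.val_injective, q, hq', ?_⟩
    rw [hv, hprim]
    have : padicValNat 2 (Nat.card W.sha) = 6 := by omega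
    exact_mod_cast this.symm

end Consumers

/-! ## §3 The two LISTED rows, conditional on an `8`-descent datum the cell does NOT hold -/

/-- **The LOWER crux at `p = 140557` from an `8`-descent.** From `PublishedFactsTwo`, the CERTIFIED
certificate `hq : #Ш_an(E_{140557}) = 64` (kit j252371: two engines, `S ∈ [63.99785, 64.00040]`, unique
lattice point `4³·1`, certified generator; `#Ш(E′) = 169`, `m(140557) = 3`) and the DISPLAYED, NOT
HELD `8`-descent datum `hS8 : Ш(E_{140557})[2] ≅ (ℤ/2)² ⊆ 4·Ш(E_{140557})` (the Cassels–Tate pairing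
between `Sel₂` and `Sel₄` trivial; WANTED W-K7t-8descent): the body of `HeegnerIndexLowerAtTwoHSY` at
`p = 140557` in every frame (`ord₂ 𝔮 = 6 ≤ ord₂ #Ш`). The `2`-descent half of `hS8` (Klein four,
`Ш[2] ⊆ 2·Ш`) IS certified (`ellrank = [1, 3, 0]`); the `⊆ 4·Ш` half is exactly what is missing.
CONDITIONAL; EVIDENCE consumer; nothing claimed. [cite: HuShuYin2019, Thm. 1.3 and Thm. 1.4 (p. 3)]
[cite: BurungaleFlach2024, Thm. 1.1 and Cor. 2] [cite: Miller2011LMS, §1 and Def. 1.1] [cite: Cremona1997, §3.6] -/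
theorem sylvesterTwoHeegnerIndex_heegnerIndexLowerAtTwoHSY_140557_of_eightDescent (hF : PublishedFactsTwo)
    (hq : ∀ (W : WeierstrassCurve ℚ) [W.IsElliptic] [W.IsGloballyMinimal],
      (∃ C : VariableChange ℚ, C • W = cubeSumCurve ((140557 : ℕ) : ℚ)) → shaAn W = ((64 : ℚ) : ℂ))
    (hS8 : ∀ (W : WeierstrassCurve ℚ) [W.IsElliptic] [W.IsGloballyMinimal],
      (∃ C : VariableChange ℚ, C • W = cubeSumCurve ((140557 : ℕ) : ℚ)) →
        (∃ x y : W.sha, (2 : ℤ) • x = 0 ∧ (2 : ℤ) • y = 0 ∧ x ≠ 0 ∧ y ≠ 0 ∧ x ≠ y) ∧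
        (∀ z : W.sha, (2 : ℤ) • z = 0 → ∃ w : W.sha, (4 : ℤ) • w = z)) :
    ∀ (W : WeierstrassCurve ℚ) [W.IsElliptic] [W.IsGloballyMinimal],
      (∃ C : VariableChange ℚ, C • W = cubeSumCurve ((140557 : ℕ) : ℚ)) →
      ∀ (N : ℕ) [NeZero N] (K : Type) [Field K] [NumberField K]
        (Dt : ModularParametrizationData W N) (H : HeegnerDatum N (NumberField.discr K)) (ι : K →+* ℂ)
        (P : (W.baseChange K).toAffine.Point) (Wd : WeierstrassCurve ℚ) [Wd.IsElliptic]
        [Wd.IsGloballyMinimal] (Cd : VariableChange ℚ) (k : ℕ),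
        W.HasCM → W.analyticRank = 1 → IsImaginaryQuadratic K → SatisfiesHeegnerHypothesis N K →
        WeierstrassCurve.Affine.Point.map ι.toRatAlgHom P = heegnerPointComplex Dt H →
        (W.quadraticTwist (NumberField.discr K : ℚ)).entireLFunction 1 ≠ 0 →
        Cd • W.quadraticTwist (NumberField.discr K : ℚ) = Wd → (k = 1 ∨ k = 2) →
        (k = 2 ↔ ∀ y : W.toAffine.Point, ∃ Q : (W.baseChange K).toAffine.Point,
          QuadraticDescent.incl K W y - (2 : ℤ) • Q ∈ AddCommGroup.torsion (W.baseChange K).toAffine.Point) →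
        padicValRat 2 (cmHeegnerIndexQuotient W K P Dt.c k Wd Cd.u) ≤
          padicValNat 2 (Nat.card W.sha) :=
  lower_member_of_cert64 hsy_140557 hF (q := 64) padicValRat_two_64.le hq hS8

/-- **The LOWER crux at `p = 381181` from an `8`-descent** — same shape: CERTIFIED `#Ш_an(E_{381181}) = 64`
(kit j253339: `S ∈ [63.99817, 64.00031]`, `#Ш(E′) = 529`, `m(381181) = 3`, `ellrank = [1, 3, 0]`) and
the DISPLAYED, NOT HELD `8`-descent datum `hS8`. CONDITIONAL; EVIDENCE consumer; nothing claimed.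
[cite: HuShuYin2019, Thm. 1.3 and Thm. 1.4 (p. 3)] [cite: BurungaleFlach2024, Thm. 1.1 and Cor. 2]
[cite: Miller2011LMS, §1 and Def. 1.1] [cite: Cremona1997, §3.6] -/
theorem sylvesterTwoHeegnerIndex_heegnerIndexLowerAtTwoHSY_381181_of_eightDescent (hF : PublishedFactsTwo)
    (hq : ∀ (W : WeierstrassCurve ℚ) [W.IsElliptic] [W.IsGloballyMinimal],
      (∃ C : VariableChange ℚ, C • W = cubeSumCurve ((381181 : ℕ) : ℚ)) → shaAn W = ((64 : ℚ) : ℂ))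
    (hS8 : ∀ (W : WeierstrassCurve ℚ) [W.IsElliptic] [W.IsGloballyMinimal],
      (∃ C : VariableChange ℚ, C • W = cubeSumCurve ((381181 : ℕ) : ℚ)) →
        (∃ x y : W.sha, (2 : ℤ) • x = 0 ∧ (2 : ℤ) • y = 0 ∧ x ≠ 0 ∧ y ≠ 0 ∧ x ≠ y) ∧
        (∀ z : W.sha, (2 : ℤ) • z = 0 → ∃ w : W.sha, (4 : ℤ) • w = z)) :
    ∀ (W : WeierstrassCurve ℚ) [W.IsElliptic] [W.IsGloballyMinimal],
      (∃ C : VariableChange ℚ, C • W = cubeSumCurve ((381181 : ℕ) : ℚ)) →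
      ∀ (N : ℕ) [NeZero N] (K : Type) [Field K] [NumberField K]
        (Dt : ModularParametrizationData W N) (H : HeegnerDatum N (NumberField.discr K)) (ι : K →+* ℂ)
        (P : (W.baseChange K).toAffine.Point) (Wd : WeierstrassCurve ℚ) [Wd.IsElliptic]
        [Wd.IsGloballyMinimal] (Cd : VariableChange ℚ) (k : ℕ),
        W.HasCM → W.analyticRank = 1 → IsImaginaryQuadratic K → SatisfiesHeegnerHypothesis N K →
        WeierstrassCurve.Affine.Point.map ι.toRatAlgHom P = heegnerPointComplex Dt H →
        (W.quadraticTwist (NumberField.discr K : ℚ)).entireLFunction 1 ≠ 0 →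
        Cd • W.quadraticTwist (NumberField.discr K : ℚ) = Wd → (k = 1 ∨ k = 2) →
        (k = 2 ↔ ∀ y : W.toAffine.Point, ∃ Q : (W.baseChange K).toAffine.Point,
          QuadraticDescent.incl K W y - (2 : ℤ) • Q ∈ AddCommGroup.torsion (W.baseChange K).toAffine.Point) →
        padicValRat 2 (cmHeegnerIndexQuotient W K P Dt.c k Wd Cd.u) ≤
          padicValNat 2 (Nat.card W.sha) :=
  lower_member_of_cert64 hsy_381181 hF (q := 64) padicValRat_two_64.le hq hS8

end SylvesterTwoLowerCert

end Summit.BirchSwinnertonDyer.BirchSwinnertonDyer.Theorems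

end
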